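/-
Copyright (c) 2026 the pub-hodgecm-mathlib formalisation cell (harness21).  R90-TF SLAB, section S10 (Rogawski 1990, Ch. 13.5–13.8 comparison engine read at `v`),
prover R90-C138-p02 (g0) — card A2d `sock_S10_levelCutG` (DEAL-S10-WAVE1), PAYER modulo named inputs (one theorem, 0 sorry); h413 = `stmt-HodgeConjecture-24833`, route `HCCMUnconditional`.
-/
import Summits.HodgeConjecture.HodgeConjecture.Theorems.R90S10GCutMemberFlathDefs     -- ★ (this seat): `S10MemberFlath` (the per-member Flath ⊗ archimedean package); brings ★ C2 `S10GCutCore`, `S10MemG`, `MatchE1`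
import Summits.HodgeConjecture.HodgeConjecture.Theorems.R90S10CutCountable            -- ★ p862093: `countable_of_injective_discreteClass_unitary` (`hcount`)
import Summits.HodgeConjecture.HodgeConjecture.Theorems.R90S5DiscreteClassMultPos      -- ★ S5: `DiscreteClass.mult_pos` (`hpos`), `DiscreteClass.mult_mk_lt_top` (`hfin` from row 3)
import Summits.HodgeConjecture.HodgeConjecture.Theorems.K2E1bCDPseudoCoeffDefs         -- ★ E1b: `hasArchOpTrace_unique` (the basis-free trace is unique)
import HarnessLib

/-!
# R90-TF ∕ S10 — A2d `sock_S10_levelCutG` MODULO NAMED INPUTS: the core of the `G`-side cut of (13.8.3) from per-member Flath packages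
# (`Theorems/R90S10GCutCoreOfEnumeration.lean`; ns `Summit.HodgeConjecture.HodgeConjecture.R90.S10`; one theorem `levelCutG_of_memberFlath`)

Cell `hodgecm-mathlib`, crux H413 (`stmt-HodgeConjecture-24833`), route of record `HCCMUnconditional`; programme R90-TF (brief `director/R90-BRIEF.v2.md`), section S10
(base `R90-C138`), dealer R90-C138-plan (g2), DEAL-S10-WAVE1 hand p02.  PROOF lane (`--kind proof --supports stmt-HodgeConjecture-24833 --as helper`): one theorem; no `def`,
no instance, no notation, no named fact, no `sorry`; imports ★ only (no `Lines` import, law L9 «defs down»).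

THE SOCKET.  A2d `sock_S10_levelCutG` (`Cruxes/H413/Lines/R90_S10_SimpleTF1383A.lean` :311–:342): under ⟪P⟫ ⟪U⟫ `h3` ⟪I⟫, `∀ 𝔥 𝔳, Nonempty (S10GCutCore … 𝔥 𝔳)` — the
CORE of the `G`-side cut of (13.8.3) [Rogawski1990, §13.8 p. 218 L5–L7 «the sum is over cuspidal `π` on `G` such that `ψ_G(t(π)) = t`», p. 219 L1–L5 «`Σ_π ε_π m(π)
Tr(π^∞(f^∞)) = Tr(ρ^∞(f^{H,∞}))`, `ε_π = ±1`»]: an automorphic measure and a Haar measure on `U(Φ₃)`, a COUNTABLE INJECTIVE family of primitive occurrence witnesses with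
`0 < m(π_i) < ⊤`, their Flath data unramified off `v` with spherical lines, signs `ε_i = a_i = ±1`, (B1) the arch–fin split, THE FIBRE (`hfib`) and EXHAUSTIVENESS (`hexh`)
over THE membership predicate ★ `S10MemG` (★ C2 `Theorems/R90S10FrozenDatumDefs.lean` :557–:668).

THE THEOREM `levelCutG_of_memberFlath` (A2d's conclusion at given `𝔥`, `𝔳`, for a given automorphic `μG` and Haar `νG`, MODULO EXACTLY TWO NAMED INPUTS):
(1) `multiplicity_lt_top_of_mem_discreteSpectrum (G3 L) μG` — ★ Literature predicate «every discrete automorphic representation of `U(Φ₃)` occurs with FINITE multiplicity»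
    [BorelJacquet1979 §4.6] = E1 row 3 at `(G3 L, μG)`; ★-payable today modulo E1's live 12R3 `CmResidualSpectrumCompactR L 3 μG` by ★
    `finiteMultiplicitiesUnitary_of_discreteSpectrumCompact_datum` ∘ ★ `cm_discreteSpectrumCompact_of_cusp_of_residualR` ∘ ★ `sig_K2E1CuspCompactU3R_holds` (the chain of
    `Lines/R90_S5_QuasiSplitRigidityD.lean` :557);
(2) `∀ c πc, S10MemG … μG c πc → (∃ f^H φ, MatchE1 … f^H φ ∧ Tr c(𝔳.ΦG φ) ≠ 0) → Nonempty (S10MemberFlath … 𝔥 𝔳 μG νG c πc)` — every CONTRIBUTING member class carries its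
    per-member Flath ⊗ archimedean package (★ `S10MemberFlath`, `Theorems/R90S10GCutMemberFlathDefs.lean`): the E1 Flath desk's theorem [FlathCorvallis1979 Thm. 3;
    BorelJacquet1979 §4.3∕§4.6; Knapp1986 Thm. 10.2] + S3's spherical line at hyperspecial level [Rogawski1990 §4.9].
WHAT IS PROVED HERE (no further input): the index `ι :=` the subtype of contributing member classes (`hexh` by construction, `hinj` by `Subtype.ext`); the primitive
witnesses `P i`, the finite components `σf i` with `hPσf`, `hσf` from the membership's ★ `IsLinked` clause, transported along the package's `hcls : [ρ w] = πc w`; `hfib` from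
the membership's ★ `LiesOver` clause likewise; `hcount` by ★ `countable_of_injective_discreteClass_unitary` [BorelJacquet1979 §4.6; Dixmier §5.4]; `hpos` by ★
`DiscreteClass.mult_pos`; `hfin` by ★ `DiscreteClass.mult_mk_lt_top` from (1); (B1) `hsplit` = the package's; and THE SIGN CLAUSE (AUDIT S10#5 N7) — `a_i = ±1` — PROVED:
the member CONTRIBUTES (`Tr c(𝔳.ΦG φ) ≠ 0` for some matched pair) so `a_i ≠ 0` by `hsplit`, while `a_i = Θ_{π_{i,∞}}(f_∞)` (the package's `hop`) lies in `{0, 1, −1}` by the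
frozen vector's sign test `𝔳.htrG : IsArchSignTest 𝔥.νGi 𝔳.fGi` [Rogawski1990 §13.8 p. 218 L24–L28] and uniqueness of the basis-free trace (★ `hasArchOpTrace_unique`); then
`ε_i := a_i` read in `{±1}` gives `hε`, `hsign`.
THE PAYMENT (for the typist of FILE A, next edition, proof-only): `obtain ⟨μG, hμG⟩ := exists_isAutomorphicMeasure_cmDatum_of_isHermitian …` (★), `νG :=` the product Haar
measure `ν_∞ ⊗ ν_f`, then `exact levelCutG_of_memberFlath … 𝔥 𝔳 μG νG ‹row 3› ‹member packages›` with the two inputs as NEW NAMED sockets (or their ★ payers).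
WHY THE HYPOTHESES ARE HONEST: (1) is print's finiteness of multiplicities; (2) is satisfiable for every genuine member (Flath + «AFA» + the spherical line; `hop` ∧ `hsplit` fix
the normalisation `νG = ν_∞ ⊗ ν_f`, which the payer chooses) and is quantified over contributing `S10MemG`-classes only — exactly the classes (13.8.3) sums over.
HONEST LABEL: closes A2d only MODULO the two named inputs (a helper ★ pays no socket until the Lines edition names it); HC_CM is proved only modulo the 7 printed citations
(2 remaining named inputs: hLiu418 = `stmt-HodgeConjecture-24832`, h413 = `stmt-HodgeConjecture-24833`) until rung 0 closes; REL ≠ ★ ≠ BUILT; count-neutral.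

## References
* [Rogawski1990] J. D. Rogawski, *Automorphic Representations of Unitary Groups in Three Variables*, Ann. of Math. Stud. 123 (1990), §13.8 Prop. 13.8.3 (proof) pp. 218–219;
  §13.6 (13.6.1) p. 208; §4.9 Prop. 4.9.1 p. 55.
* [BorelJacquet1979] A. Borel, H. Jacquet, *Automorphic forms and automorphic representations*, PSPM 33.1 (1979), §4.3, §4.6.
* [FlathCorvallis1979] D. Flath, *Decomposition of representations into tensor products*, PSPM 33.1 (1979), Thms. 3–4.
* [Knapp1986] A. Knapp, *Representation Theory of Semisimple Groups* (1986), Thm. 10.2.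
* [Dixmier1977] J. Dixmier, *C*-algebras* (1977), §5.4.
-/

set_option autoImplicit false
set_option linter.dupNamespace false

noncomputable section

open scoped RestrictedProduct Matrix MatrixGroups
open Filter MeasureTheory NumberField IsDedekindDomain CompactlySupported
open Literature.NumberTheory.Rogawski1990 Literature.NumberTheory.Automorphic Literature.NumberTheory.Automorphic.UnitaryGroup
open Literature.NumberTheory.Automorphic.UnitaryGroup.CotangentForms Literature.NumberTheory.GaloisRepresentations
open Literature.NumberTheory.Automorphic.Arthur2013.Leaves.TECR
open Summit.HodgeConjecture.HodgeConjecture.Cruxes.H413.K2E1TraceFormulaBeta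
open Summit.HodgeConjecture.HodgeConjecture.Cruxes.H413.K2E1SpectralTermsDiscreteHalf
open Summit.HodgeConjecture.HodgeConjecture.Cruxes.H413.K2E1bGKCohomologyU21.U8 (HasArchOpTrace hasArchOpTrace_unique)

namespace Summit.HodgeConjecture.HodgeConjecture.R90.S10

section Payer

variable (L : Type) [Field L] [NumberField L] [IsCMField L] [DecidableEq (Pl L)] (μ : HeckeCharacter L) (v : Pl L)
  [MeasurableSpace (HLoc L v)] [BorelSpace (HLoc L v)] [MeasurableSpace (Gqs L v)] [BorelSpace (Gqs L v)]
  (νHv : Measure (HLoc L v)) (νQv : Measure (Gqs L v)) [νHv.IsHaarMeasure] [νHv.IsMulRightInvariant] [νQv.IsHaarMeasure] [νQv.IsMulRightInvariant]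
  [∀ a : HLoc L v, MeasurableSpace (HLoc L v ⧸ Subgroup.centralizer ({a} : Set (HLoc L v)))]
  [∀ a : HLoc L v, BorelSpace (HLoc L v ⧸ Subgroup.centralizer ({a} : Set (HLoc L v)))]
  [∀ γ : Gqs L v, MeasurableSpace (Gqs L v ⧸ Subgroup.centralizer ({γ} : Set (Gqs L v)))]
  [∀ γ : Gqs L v, BorelSpace (Gqs L v ⧸ Subgroup.centralizer ({γ} : Set (Gqs L v)))]
  (mHv : OrbitalMeasureFamily (HLoc L v)) (mQv : OrbitalMeasureFamily (Gqs L v)) (πSt : IrrClass (HLoc L v))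
  [MeasurableSpace (G3 L).Adelic] [BorelSpace (G3 L).Adelic] [MeasurableSpace (H2 L).Adelic] [BorelSpace (H2 L).Adelic]
  [MeasurableSpace (GArch L)] [BorelSpace (GArch L)] [MeasurableSpace (HArch L)] [BorelSpace (HArch L)]
  [MeasurableSpace (H1Loc L v)] [MeasurableSpace (H1Arch L)] [MeasurableSpace (H1 L).Adelic] [BorelSpace (H1 L).Adelic]

/-- **A2d `sock_S10_levelCutG` MODULO NAMED INPUTS — THE CORE OF THE `G`-SIDE CUT OF (13.8.3) FROM PER-MEMBER FLATH PACKAGES.**  Given the `H`-datum `𝔥`, the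
frozen vector `𝔳`, an automorphic measure `μG` and a Haar measure `νG` on `U(Φ₃)`: ★ `S10GCutCore 𝔥 𝔳` is inhabited as soon as (1) every discrete automorphic
representation of `U(Φ₃)` has finite multiplicity at `μG` (★ `multiplicity_lt_top_of_mem_discreteSpectrum`, E1 row 3 [BorelJacquet1979, §4.6]) and (2) every CONTRIBUTING
class satisfying THE membership predicate ★ `S10MemG` carries its Flath ⊗ archimedean package ★ `S10MemberFlath` [FlathCorvallis1979, Thm. 3].  CONSTRUCTION: `ι :=` the
subtype of contributing member classes (`hexh` by construction, `hinj` by `Subtype.ext`); `P i`, `σf i`, `hPσf`, `hσf` from the membership's ★ `IsLinked` clause and `hfib`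
from its ★ `LiesOver` clause, transported along `hcls : [ρ w] = πc w`; `hcount` ★ `countable_of_injective_discreteClass_unitary`; `hpos` ★ `DiscreteClass.mult_pos`; `hfin`
★ `DiscreteClass.mult_mk_lt_top` from (1); the SIGN `a_i = ±1` PROVED from `𝔳.htrG` (`Θ_ϖ(f_∞) ∈ {0, ±1}` for irreducible unitary `ϖ`), the package's `hop`
(`a_i = Θ_{π_{i,∞}}(f_∞)`, ★ `hasArchOpTrace_unique`) and «the member contributes ⇒ `a_i ≠ 0`» (`hsplit`); `ε_i := a_i` read in `{±1}`.
[cite: Rogawski1990, §13.8 (13.8.3) p. 218 L5–L7 and L22–L28, p. 219 L1–L5; §13.6 (13.6.1) p. 208] [cite: BorelJacquet1979, §4.6] [cite: FlathCorvallis1979, Thm. 3]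
[cite: Knapp1986, Thm. 10.2] -/
theorem levelCutG_of_memberFlath (𝔥 : S10HDatum L μ v νHv νQv mHv mQv πSt) (𝔳 : S10Frozen L μ v νHv νQv mHv mQv πSt 𝔥)
    (μG : Measure (G3 L).automorphicQuotient) [(G3 L).IsAutomorphicMeasure μG] (νG : Measure (G3 L).Adelic) [νG.IsHaarMeasure]
    (hfinG : multiplicity_lt_top_of_mem_discreteSpectrum (G3 L) μG)
    (hflath : ∀ (c : DiscreteClass (G3 L) μG) (πc : ∀ w : Pl L, IrrClass (Gqs L w)), S10MemG L μ v νHv νQv mHv mQv πSt 𝔥 𝔳 μG c πc →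
      (∃ fH φ, MatchE1 L μ v mHv mQv fH φ ∧ c.classTrace νG (𝔳.ΦG φ) ≠ 0) → Nonempty (S10MemberFlath L μ v νHv νQv mHv mQv πSt 𝔥 𝔳 μG νG c πc)) :
    Nonempty (S10GCutCore L μ v νHv νQv mHv mQv πSt 𝔥 𝔳) := by
  classical
  -- the index: the CONTRIBUTING member classes
  let ι : Type := {c : DiscreteClass (G3 L) μG // ∃ πc : ∀ w : Pl L, IrrClass (Gqs L w), S10MemG L μ v νHv νQv mHv mQv πSt 𝔥 𝔳 μG c πc ∧
    ∃ fH φ, MatchE1 L μ v mHv mQv fH φ ∧ c.classTrace νG (𝔳.ΦG φ) ≠ 0}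
  have hπ : ∀ i : ι, ∃ πc : ∀ w : Pl L, IrrClass (Gqs L w), S10MemG L μ v νHv νQv mHv mQv πSt 𝔥 𝔳 μG i.1 πc ∧
      ∃ fH φ, MatchE1 L μ v mHv mQv fH φ ∧ i.1.classTrace νG (𝔳.ΦG φ) ≠ 0 := fun i => i.2
  choose πc hmem hcon using hπ
  -- the Flath packages of the members
  have h𝔪 : ∀ i : ι, Nonempty (S10MemberFlath L μ v νHv νQv mHv mQv πSt 𝔥 𝔳 μG νG i.1 (πc i)) := fun i => hflath i.1 (πc i) (hmem i) (hcon i)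
  let 𝔪 : ∀ i : ι, S10MemberFlath L μ v νHv νQv mHv mQv πSt 𝔥 𝔳 μG νG i.1 (πc i) := fun i => Classical.choice (h𝔪 i)
  -- the primitive witnesses and finite components from the membership's `IsLinked` clause
  have hlink : ∀ i : ι, ∃ (P : DiscreteAutomorphicRep (G3 L) μG) (W : Type) (_ : AddCommGroup W) (_ : Module ℂ W)
      (σf : Representation ℂ (finAdelic (↥(maximalRealSubfield L)) L (IsCMField.complexConj L) 3 (qsForm L)) W),
      DiscreteClass.mk P = i.1 ∧ P.HasFinComponent σf ∧ HasLocalClasses L 3 (qsForm L) σf (πc i) := fun i => (hmem i).1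
  choose P Wf acWf mdWf σf hPc hPσf hσf using hlink
  -- the signs: `a_i ≠ 0` (the member CONTRIBUTES) and `Θ_{π_∞}(f_∞) ∈ {0, ±1}` (`𝔳.htrG`) ⇒ `a_i = ±1`
  have hsgn : ∀ i : ι, (𝔪 i).a = 1 ∨ (𝔪 i).a = -1 := fun i => by
    have ha0 : (𝔪 i).a ≠ 0 := by
      obtain ⟨fH, φ, hM, hne⟩ := hcon i
      intro h0
      apply hne
      rw [(𝔪 i).hsplit fH φ hM, h0, zero_mul]
    haveI := 𝔥.hνGi
    letI := (𝔪 i).nacgE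
    letI := (𝔪 i).ipsE
    letI := (𝔪 i).csE
    rcases 𝔳.htrG (𝔪 i).E (𝔪 i).ϖ (𝔪 i).hu (𝔪 i).hsc (𝔪 i).hirri with h | h | h
    · exact absurd (hasArchOpTrace_unique _ _ _ _ _ (𝔪 i).hop h) ha0
    · exact Or.inl (hasArchOpTrace_unique _ _ _ _ _ (𝔪 i).hop h)
    · exact Or.inr (hasArchOpTrace_unique _ _ _ _ _ (𝔪 i).hop h)
  let ε : ι → ℤ := fun i => if (𝔪 i).a = 1 then 1 else -1
  have hε : ∀ i, ε i = 1 ∨ ε i = -1 := fun i => by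
    by_cases h : (𝔪 i).a = 1 <;> simp [ε, h]
  have hsign : ∀ i, (𝔪 i).a = ε i := fun i => by
    rcases hsgn i with h | h
    · simp [ε, h]
    · simp [ε, h]
  -- injectivity, countability, multiplicities
  have hinj : Function.Injective fun i : ι => DiscreteClass.mk (P i) := fun i i' h =>
    Subtype.ext (((hPc i).symm.trans h).trans (hPc i'))
  have hcount : Countable ι := countable_of_injective_discreteClass_unitary L 3 (qsForm L) μG (fun i : ι => DiscreteClass.mk (P i)) hinj
  have hfin : ∀ i : ι, (DiscreteClass.mk (P i)).mult < ⊤ := fun i => DiscreteClass.mult_mk_lt_top hfinG (P i)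
  have hpos : ∀ i : ι, 0 < (DiscreteClass.mk (P i)).mult := fun i => DiscreteClass.mult_pos _
  -- the package's local models as smooth irreducibles, and their classes
  let r : ∀ (i : ι) (w : Pl L), SmoothIrrep (Gqs L w) := fun i w =>
    { V := (𝔪 i).V w, instAddCommGroup := (𝔪 i).acV w, instModule := (𝔪 i).mdV w, ρ := (𝔪 i).ρ w, isIrreducible := (𝔪 i).hirr w, isSmooth := (𝔪 i).hsm w }
  have hcls : ∀ (i : ι) (w : Pl L), IrrClass.mk (r i w) = πc i w := fun i w => (𝔪 i).hcls w
  have hcls' : ∀ i : ι, (fun w => IrrClass.mk (r i w)) = πc i := fun i => funext (hcls i)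
  have hσf' : ∀ i : ι, HasLocalClasses L 3 (qsForm L) (σf i) fun w => IrrClass.mk (r i w) := fun i => by
    rw [hcls' i]; exact hσf i
  have hfib : ∀ (i : ι) (w : {w : Pl L // w ≠ v}),
      LiesOver L μ w.1 (𝔳.K w.1) (𝔥.KH w.1) (𝔳.νQ w) (𝔳.νHw w) (𝔳.mH w) (𝔳.mQ w) (IrrClass.mk (r i w.1)) (𝔥.ρ w.1) := fun i w => by
    rw [hcls i w.1]; exact (hmem i).2 w
  -- (B1) at the members
  have hsplit : ∀ (i : ι) fH φ, MatchE1 L μ v mHv mQv fH φ →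
      (DiscreteClass.mk (P i)).classTrace νG (𝔳.ΦG φ) =
        (𝔪 i).a * (haveI := 𝔳.hKo; @Representation.smoothTrace _ _ _ _ 𝔳.msF _ (𝔪 i).acW (𝔪 i).mdW (𝔪 i).σ 𝔳.νf
          (fun g : Πʳ w : Pl L, [Gqs L w, 𝔳.K w] => φ (g v) *
            Set.indicator {g : Πʳ w : Pl L, [Gqs L w, 𝔳.K w] | ∀ w, w ≠ v → g w ∈ 𝔳.K w} (fun _ => (1 : ℂ)) g)) := fun i fH φ hM => by
    rw [hPc i]; exact (𝔪 i).hsplit fH φ hM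
  -- exhaustiveness by construction
  have hexh : ∀ (c : DiscreteClass (G3 L) μG) (πc' : ∀ w : Pl L, IrrClass (Gqs L w)), S10MemG L μ v νHv νQv mHv mQv πSt 𝔥 𝔳 μG c πc' →
      (∃ fH φ, MatchE1 L μ v mHv mQv fH φ ∧ c.classTrace νG (𝔳.ΦG φ) ≠ 0) → c ∈ Set.range fun i : ι => DiscreteClass.mk (P i) :=
    fun c πc' hm hc => ⟨⟨c, πc', hm, hc⟩, hPc _⟩
  exact ⟨{
    μG := μG, νG := νG, ι := ι, hcount := hcount, P := P, hinj := hinj, hfin := hfin, hpos := hpos, ε := ε, hε := hε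
    a := fun i => (𝔪 i).a, Vc := fun i => (𝔪 i).V, acVc := fun i => (𝔪 i).acV, mdVc := fun i => (𝔪 i).mdV, ρc := fun i => (𝔪 i).ρ
    hirrc := fun i => (𝔪 i).hirr, hsmc := fun i => (𝔪 i).hsm, x₀c := fun i => (𝔪 i).x₀, Wc := fun i => (𝔪 i).W, acWc := fun i => (𝔪 i).acW
    mdWc := fun i => (𝔪 i).mdW, σ := fun i => (𝔪 i).σ, hx₀c := fun i => (𝔪 i).hx₀, jc := fun i => (𝔪 i).j, S₀c := fun i => (𝔪 i).S₀
    hσ := fun i => (𝔪 i).hσ, hS₀c := fun i => (𝔪 i).hS₀, hlinec := fun i => (𝔪 i).hline, hadmc := fun i => (𝔪 i).hadm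
    Wf := Wf, acWf := acWf, mdWf := mdWf, σf := σf, hPσf := hPσf, hσf := hσf', hsplit := hsplit, hsign := hsign, hfib := hfib, hexh := hexh }⟩

end Payer

end Summit.HodgeConjecture.HodgeConjecture.R90.S10

end
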